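import Mathlib
import HarnessLib
import Literature.MathematicalPhysics.QuantumLattice.HubbardCounterQuadraticResummation
import Literature.MathematicalPhysics.QuantumLattice.HubbardUVSymbolCTDifferences
import Literature.MathematicalPhysics.QuantumLattice.HubbardResummedCovarianceDetBound
import Summits.HubbardSuperconductivity.HubbardSuperconductivity.Theorems.KLProgrammeKLRegimeEngineSelfEnergySymmetric
import Summits.HubbardSuperconductivity.HubbardSuperconductivity.Theorems.KLProgrammeKLRegimeSplitTwoLegF
import Summits.HubbardSuperconductivity.HubbardSuperconductivity.Theorems.KLProgrammeKLRegimeTwoVolumeDressedReadout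

/-!
# Route `KLProgramme` — ENGINE child `KLRegimeEngineV16` (stmt-HubbardSuperconductivity-20236), `stub_twoLeg_scale0`, conjunct
# (E3f-AT)₀, spatial nested leg `hsp`: the K-RESUMMED READ-OUT of the two-leg local part at two nested volumes
# (cell gate-hubbard-kl, seat hubbard-kl-k3c5-p2 g6, β′ lane, design (m1′) «momentum-first resummation», step (m5)-c, part 3 = model)

The local part `ν_n(K)(θ) = klLocalPart L M … K n θ` is the symmetrised interpolant of `klLocSelfEnergyRe … K n` evaluated at the frame's Fermi
point `klFermiPoint μ K θ` (a point of the Brillouin zone that does NOT depend on the volume).  The scale-`n` action is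
`effAction C (V_U + 𝒩_K)` with `C = C^K_{>Λ_n}` at seed `0` — a NORMAL covariance, `C = normalCovariance (uvSymbolCT … Λ_n)`
([tree] `hubbardCovAboveCT_zero_seed_eq_normalCovariance_uvSymbolCT`) — so the counterterm vertex can be RESUMMED at the self-energy
([tree] `HubbardCounterQuadraticResummation.selfEnergy_effAction_add_counterQuadratic`, Feldman–Salmhofer–Trubowitz 1996 §1 «`K` as a vertex»
versus «`E = e + K` in the propagator»):

  `Σ_{C, V_U+𝒩_K}((ω₀,k⃗),σ) = E(p_k⃗) + τ(p_k⃗)·Σ̃((ω₀,k⃗),σ)`,   `Σ̃ = Σ_{C̃, V_U}`,  `C̃ = normalCovariance p̃`,  `p̃ = p/(1 + pκ)`,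

with `E(q) = K(q) − K(q)²·ũ(q)`, `τ(q) = (1 − K(q)ũ(q))²`, `ũ = u/(1 + uK)`, `p = βL²·u(p_k⃗)` — FIXED continuum symbols SAMPLED on the momentum grid
(the denominators never vanish: [tree] `one_add_uvSymbolCT_mul_ne_zero`, k3c5-p1's `HubbardResummedCovarianceDetBound`).  Hence (E0) ⇒ `klLocSelfEnergyRe … k⃗ = Re Σ((ω₀,k⃗),↑)`
(`klLocSelfEnergyRe_eq_re`) `= Re E(p_k⃗) + Re[τ(p_k⃗)·Σ̃((ω₀,k⃗),↑)]`, and the two-volume difference of the local part splits into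
(i) the explicit sampled symbol — aliasing tails only (`…TwoVolumeSymInterp` §4) — and (ii) the DRESSED term — `…TwoVolumeDressedReadout` —
whose Grassmann input is the PINNED TWO-LEG GRID DEFECT of the grid representations `W̃` of the PURELY QUARTIC resummed theory `(C̃_g, V_U)` at
ONE block-centre pin, i.e. what β′ (`sum_norm_kernel_twoVolumeDefect_le`, p515439) bounds with NO interaction defect (the frame vertex is gone):

* **`abs_klLocalPart_sub_le_resummed`** — for nested volumes `Lf = b·Lc`, the same Matsubara cutoff `M`, any scale `n`, grid representations
  `map S_L W̃_L = effAction C̃_L V_U` (hypotheses `hrepc/hrepf`), unit partition functions of the framed actions (`hZc/hZf`), base-point–independent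
  phase-weighted two-leg rows of `W̃` at the string `((ω₀,·),↑)` (`hrowc/hrowf`) and the block embedding `ι` of `…TwoVolumeGridReadout`:
  `|klLocalPart Lc M … K n θ − klLocalPart Lf M … K n θ| ≤ 2·far_{Lf}|c_{Re E∘p}| + ‖τ̌_c‖₁·(2N/|β|)·Def(W̃c, W̃f) + 2·(2N/|β|)·(M₁(τ̌_f)·N₂ + ‖τ̌_f‖₁·M₂)/T`,
  `T = (Lc−1)/2+1`, every quantity a finite sum (the explicit symbols `E`, `τ` enter through a volume-free `u` with `p_L((ω₀,k⃗),↑) = βL²·u(p_k⃗)`,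
  hypotheses `huc/huf`, discharged by `uvSymbolCT_eq_uvSymbolFn`).

Proofs only; no definitions; nothing is asserted about the model beyond identities.  References: FST 1996 §1; BGM 2006 (2.21)–(2.24), §2.9.
-/

noncomputable section

namespace Summit.HubbardSuperconductivity.HubbardSuperconductivity.Theorems.TwoVolumeDefect

set_option linter.dupNamespace false -- summit = problem name (single-conjunct summit), D-0017

open Finset Complex Literature.MathematicalPhysics.QuantumLattice Literature.Probability.LatticeModels GrassmannAlgebra
open Summit.HubbardSuperconductivity.HubbardSuperconductivity.Theorems.KLRegimeSplit
open Summit.HubbardSuperconductivity.HubbardSuperconductivity.Theorems.KLProgrammeLegKernels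
open Summit.HubbardSuperconductivity.HubbardSuperconductivity.Theorems.TwoPointAssembly
open Summit.HubbardSuperconductivity.HubbardSuperconductivity.Theorems.TwoLegFourier
open scoped ComplexConjugate

/-! ## §1 The scale-`n` self-energy in normal-covariance form; the localised value is `Re Σ((ω₀,·),↑)` -/

section Model

variable {L M : ℕ} [NeZero L] [NeZero M]

omit [NeZero M] in
/-- The scale-`n` self-energy of the KL programme is the self-energy of `effAction (normalCovariance p) (V_U + 𝒩_K)` with `p = uvSymbolCT … Λ_n`. -/
theorem klSelfEnergy_eq_selfEnergy_normalCovariance (β U μ : ℝ) (K : TrigPolyC4v) (e₀ : ℝ) (n : ℕ) (k : FreqMomentum L M) (σ : Fin 2) :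
    klSelfEnergy L M β U μ K e₀ n k σ =
      selfEnergy L M β (effAction ℂ (normalCovariance L M (uvSymbolCT L M β μ K (klScale e₀ n)))
        (hubbardInteraction L M β U + counterQuadratic L M β K)) k σ := by
  rw [klSelfEnergy, klEffectiveAction, hubbardEffectiveActionCT_def, hubbardInteractionCT,
    hubbardCovAboveCT_zero_seed_eq_normalCovariance_uvSymbolCT]

/-- **(E0) collapses the localised value**: `klLocSelfEnergyRe … K n k⃗ = Re Σ_n((ω₀,k⃗),↑)`. -/
theorem klLocSelfEnergyRe_eq_re (β U μ : ℝ) (K : TrigPolyC4v) (n : ℕ) (k : TorusSite 2 L) :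
    klLocSelfEnergyRe L M β U μ K n k = (klSelfEnergy L M β U μ K klE0 n (omega0 M, k) 0).re := by
  unfold klLocSelfEnergyRe
  simp only [Fin.sum_univ_two, klSelfEnergy_revFreq, Complex.conj_re, klSelfEnergy_spin_eq L M β U μ K klE0 n (omega0 M, k) 1]
  ring

omit [NeZero M] in
/-- `uvSymbolCT` is even in the spatial momentum. -/
theorem uvSymbolCT_neg_momentum (β μ : ℝ) (K : TrigPolyC4v) (Λ : ℝ) (i : MatsubaraIdx M) (kv : TorusSite 2 L) (σ : Fin 2) :
    uvSymbolCT L M β μ K Λ ((i, -kv), σ) = uvSymbolCT L M β μ K Λ ((i, kv), σ) := by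
  simp only [uvSymbolCT, hubbardCutoffWeightCT, nambuXiCT_neg, nambuDenCT_zero_seed]

omit [NeZero M] in
/-- The framed interaction data for the resummation theorem: `V_U` is even, has no constant part. -/
theorem hubbardInteraction_mem_evenPart (β U : ℝ) : hubbardInteraction L M β U ∈ evenPart ℂ (HubbardFieldIdx L M) := by
  rw [mem_evenPart_iff, hubbardInteraction]
  refine Submodule.smul_mem _ _ (Submodule.sum_mem _ fun k₁ _ => Submodule.sum_mem _ fun k₂ _ =>
    Submodule.sum_mem _ fun k₃ _ => Submodule.sum_mem _ fun k₄ _ => ?_)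
  split_ifs
  · rw [mul_assoc]
    exact mul_mem_evenOdd_zero ℂ (gen_mul_gen_mem_evenOdd_zero ℂ _ _) (gen_mul_gen_mem_evenOdd_zero ℂ _ _)
  · exact zero_mem _

/-- Algebra of the resummed reading: with `p = c·u`, `κ = Kp/c` (`c = βL² ≠ 0`) the explicit terms are volume-free functions of `(u, Kp)`. -/
theorem resum_reading_algebra (c Kp : ℝ) (hc : c ≠ 0) (u S : ℂ) (h1 : 1 + u * Kp ≠ 0) :
    (c : ℂ) * ((Kp / c : ℝ) : ℂ) - (c : ℂ) * ((Kp / c : ℝ) : ℂ) ^ 2 * ((c : ℂ) * u / (1 + (c : ℂ) * u * ((Kp / c : ℝ) : ℂ))) +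
      (1 - ((Kp / c : ℝ) : ℂ) * ((c : ℂ) * u / (1 + (c : ℂ) * u * ((Kp / c : ℝ) : ℂ)))) ^ 2 * S =
    ((Kp : ℂ) - (Kp : ℂ) ^ 2 * (u / (1 + u * Kp))) + (1 - (Kp : ℂ) * (u / (1 + u * Kp))) ^ 2 * S := by
  have hcc : (c : ℂ) ≠ 0 := by exact_mod_cast hc
  have hk : ((Kp / c : ℝ) : ℂ) = (Kp : ℂ) / (c : ℂ) := by push_cast; ring
  rw [hk]
  have h2 : 1 + (c : ℂ) * u * ((Kp : ℂ) / (c : ℂ)) = 1 + u * Kp := by field_simp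
  rw [h2]
  field_simp

omit [NeZero M] in
/-- **THE RESUMMED READING OF THE SCALE-`n` SELF-ENERGY** at a string `((i,k⃗),σ)`: with `u` volume-free such that `p((i,k⃗),σ) = βL²·u(p_k⃗)`,
`Σ_n((i,k⃗),σ) = [K(p_k⃗) − K(p_k⃗)²·ũ] + (1 − K(p_k⃗)·ũ)²·Σ̃((i,k⃗),σ)`, `ũ = u/(1 + u·K(p_k⃗))`, `Σ̃` the self-energy of the purely quartic theory
with the resummed normal covariance `p̃ = p/(1 + pκ)`. -/
theorem klSelfEnergy_eq_resummed {β : ℝ} (hβ : 0 < β) (U μ : ℝ) (K : TrigPolyC4v) (n : ℕ) (i : MatsubaraIdx M) (kv : TorusSite 2 L) (σ : Fin 2)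
    (hZ : IsUnit (effPartitionFn ℂ (normalCovariance L M (uvSymbolCT L M β μ K (klScale klE0 n)))
      (hubbardInteraction L M β U + counterQuadratic L M β K)))
    (u : ℂ) (hu : uvSymbolCT L M β μ K (klScale klE0 n) ((i, kv), σ) = ((β * (L : ℝ) ^ 2 : ℝ) : ℂ) * u) :
    klSelfEnergy L M β U μ K klE0 n (i, kv) σ =
      ((K.eval (latticeMomentum L kv) : ℂ) - (K.eval (latticeMomentum L kv) : ℂ) ^ 2 * (u / (1 + u * K.eval (latticeMomentum L kv)))) +
        (1 - (K.eval (latticeMomentum L kv) : ℂ) * (u / (1 + u * K.eval (latticeMomentum L kv)))) ^ 2 *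
          selfEnergy L M β (effAction ℂ (normalCovariance L M (fun ks =>
            uvSymbolCT L M β μ K (klScale klE0 n) ks /
              (1 + uvSymbolCT L M β μ K (klScale klE0 n) ks * ((K.eval (latticeMomentum L ks.1.2) / (β * (L : ℝ) ^ 2) : ℝ) : ℂ))))
            (hubbardInteraction L M β U)) (i, kv) σ := by
  have hL : (L : ℝ) ≠ 0 := by exact_mod_cast NeZero.ne L
  have hc0 : β * (L : ℝ) ^ 2 ≠ 0 := by positivity
  have key := selfEnergy_effAction_add_counterQuadratic (uvSymbolCT L M β μ K (klScale klE0 n)) (hubbardInteraction_mem_evenPart β U)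
    (constPart_hubbardInteraction L M β U) β K (one_add_uvSymbolCT_mul_ne_zero hβ μ K (klScale klE0 n)) hZ (i, kv) σ
  rw [klSelfEnergy_eq_selfEnergy_normalCovariance, key]
  simp only []
  rw [hu]
  have h1 : 1 + u * K.eval (latticeMomentum L kv) ≠ 0 := by
    have h := one_add_uvSymbolCT_mul_ne_zero (L := L) (M := M) hβ μ K (klScale klE0 n) ((i, kv), σ)
    rw [hu] at h
    have hβc : (β : ℂ) ≠ 0 := by exact_mod_cast hβ.ne'
    have hLc : (L : ℂ) ≠ 0 := by exact_mod_cast NeZero.ne L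
    have e : ((β * (L : ℝ) ^ 2 : ℝ) : ℂ) * u * ((K.eval (latticeMomentum L kv) / (β * (L : ℝ) ^ 2) : ℝ) : ℂ) = u * K.eval (latticeMomentum L kv) := by
      push_cast
      field_simp
    rwa [e] at h
  exact resum_reading_algebra (β * (L : ℝ) ^ 2) (K.eval (latticeMomentum L kv)) hc0 u _ h1

end Model

/-! ## §2 The two-volume difference of the local part: explicit tails + the dressed read-out of the resummed quartic theory -/

section Nested

variable {b Lc Lf M : ℕ} [NeZero Lc] [NeZero Lf] [NeZero M]
variable {P P' : Type*} [Fintype P] [DecidableEq P] [Fintype P'] [DecidableEq P']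

/-- **THE K-RESUMMED TWO-VOLUME READ-OUT OF THE LOCAL PART.**  See the module docstring.  All Grassmann inputs are pinned two-leg grid sums
of the grid representations `W̃c`, `W̃f` of the PURELY QUARTIC resummed theory at the block-centre pin `ι o`; the explicit symbols
`E(q) = K(q) − K(q)²ũ(q)` and `τ(q) = (1 − K(q)ũ(q))²`, `ũ = u/(1+uK)`, enter through their sampled site kernels. -/
theorem abs_klLocalPart_sub_le_resummed (hL : Lf = b * Lc) {β : ℝ} (hβ : 0 < β) (U μ : ℝ) (K : TrigPolyC4v) (n : ℕ) {N : ℕ}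
    (xg : P → TorusSite 2 Lc) (τg : P → ℝ) (xg' : P' → TorusSite 2 Lf) (τg' : P' → ℝ)
    (hP : Fintype.card P = N * Lc ^ 2) (hP' : Fintype.card P' = N * Lf ^ 2)
    (ι : P → P') (hι : Function.Injective ι) (hιx : ∀ p, xg' (ι p) = Torus.proj Lf (Torus.cRep (xg p))) (hιτ : ∀ p, τg' (ι p) = τg p)
    (hblock : ∀ p' : P', Torus.proj Lf (Torus.cRep (fun i => (((xg' p' i).val : ℕ) : ZMod Lc))) = xg' p' → p' ∈ Set.range ι)
    {o : P} (hxo : xg o = 0)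
    (u : (Fin 2 → ℝ) → ℂ)
    (huc : ∀ kv : TorusSite 2 Lc, uvSymbolCT Lc M β μ K (klScale klE0 n) ((omega0 M, kv), 0) = ((β * (Lc : ℝ) ^ 2 : ℝ) : ℂ) * u (latticeMomentum Lc kv))
    (huf : ∀ kv : TorusSite 2 Lf, uvSymbolCT Lf M β μ K (klScale klE0 n) ((omega0 M, kv), 0) = ((β * (Lf : ℝ) ^ 2 : ℝ) : ℂ) * u (latticeMomentum Lf kv))
    (Wc : GrassmannAlgebra ℂ (GridLeg P)) (Wf : GrassmannAlgebra ℂ (GridLeg P'))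
    (hrepc : ExteriorAlgebra.map (Matrix.toLin' (gridSubMatrix Lc M β xg τg)) Wc =
      effAction ℂ (normalCovariance Lc M (fun ks => uvSymbolCT Lc M β μ K (klScale klE0 n) ks /
        (1 + uvSymbolCT Lc M β μ K (klScale klE0 n) ks * ((K.eval (latticeMomentum Lc ks.1.2) / (β * (Lc : ℝ) ^ 2) : ℝ) : ℂ))))
        (hubbardInteraction Lc M β U))
    (hrepf : ExteriorAlgebra.map (Matrix.toLin' (gridSubMatrix Lf M β xg' τg')) Wf =
      effAction ℂ (normalCovariance Lf M (fun ks => uvSymbolCT Lf M β μ K (klScale klE0 n) ks /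
        (1 + uvSymbolCT Lf M β μ K (klScale klE0 n) ks * ((K.eval (latticeMomentum Lf ks.1.2) / (β * (Lf : ℝ) ^ 2) : ℝ) : ℂ))))
        (hubbardInteraction Lf M β U))
    (hZc : IsUnit (effPartitionFn ℂ (normalCovariance Lc M (uvSymbolCT Lc M β μ K (klScale klE0 n)))
      (hubbardInteraction Lc M β U + counterQuadratic Lc M β K)))
    (hZf : IsUnit (effPartitionFn ℂ (normalCovariance Lf M (uvSymbolCT Lf M β μ K (klScale klE0 n)))
      (hubbardInteraction Lf M β U + counterQuadratic Lf M β K)))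
    (hrowc : ∀ (p₀ : P) (y : TorusSite 2 Lc),
      (∑ p₁ : P, if xg p₁ = xg p₀ + y then
        Complex.exp (((matsubaraFreq β M (omega0 M) * (τg p₀ - τg p₁) : ℝ) : ℂ) * Complex.I) * kernel ℂ Wc 2 (fun i => ((![p₀, p₁] i, 0), i))
        else 0) =
      ∑ p₁ : P, if xg p₁ = xg o + y then
        Complex.exp (((matsubaraFreq β M (omega0 M) * (τg o - τg p₁) : ℝ) : ℂ) * Complex.I) * kernel ℂ Wc 2 (fun i => ((![o, p₁] i, 0), i))
        else 0)
    (hrowf : ∀ (p₀' : P') (y : TorusSite 2 Lf),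
      (∑ p₁' : P', if xg' p₁' = xg' p₀' + y then
        Complex.exp (((matsubaraFreq β M (omega0 M) * (τg' p₀' - τg' p₁') : ℝ) : ℂ) * Complex.I) * kernel ℂ Wf 2 (fun i => ((![p₀', p₁'] i, 0), i))
        else 0) =
      ∑ p₁' : P', if xg' p₁' = xg' (ι o) + y then
        Complex.exp (((matsubaraFreq β M (omega0 M) * (τg' (ι o) - τg' p₁') : ℝ) : ℂ) * Complex.I) * kernel ℂ Wf 2 (fun i => ((![ι o, p₁'] i, 0), i))
        else 0)
    (θ : ℝ) :
    |klLocalPart Lc M β U μ K n θ - klLocalPart Lf M β U μ K n θ| ≤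
      2 * (∑ y ∈ univ.filter (fun y : TorusSite 2 Lf => Torus.proj Lf (Torus.cRep (fun i => (((y i).val : ℕ) : ZMod Lc))) ≠ y),
        |torusCosCoeff Lf (fun k => ((K.eval (latticeMomentum Lf k) : ℂ) -
          (K.eval (latticeMomentum Lf k) : ℂ) ^ 2 * (u (latticeMomentum Lf k) / (1 + u (latticeMomentum Lf k) * K.eval (latticeMomentum Lf k)))).re) y|) +
      ((∑ z : TorusSite 2 Lc, ‖torusFourierInv (fun k => (1 - (K.eval (latticeMomentum Lc k) : ℂ) *
          (u (latticeMomentum Lc k) / (1 + u (latticeMomentum Lc k) * K.eval (latticeMomentum Lc k)))) ^ 2) z‖) * (2 * N / |β| *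
        ((∑ p₁ : P, ‖kernel ℂ Wc 2 (fun i => ((![o, p₁] i, 0), i)) - kernel ℂ Wf 2 (fun i => ((![ι o, ι p₁] i, 0), i))‖) +
          ∑ p₁' ∈ univ.filter (fun p₁' : P' => p₁' ∉ Set.range ι), ‖kernel ℂ Wf 2 (fun i => ((![ι o, p₁'] i, 0), i))‖)) +
      2 * (((∑ z : TorusSite 2 Lf, (Torus.tnorm z : ℝ) * ‖torusFourierInv (fun k => (1 - (K.eval (latticeMomentum Lf k) : ℂ) *
              (u (latticeMomentum Lf k) / (1 + u (latticeMomentum Lf k) * K.eval (latticeMomentum Lf k)))) ^ 2) z‖) *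
            (2 * N / |β| * ∑ p₁' : P', ‖kernel ℂ Wf 2 (fun i => ((![ι o, p₁'] i, 0), i))‖) +
          (∑ z : TorusSite 2 Lf, ‖torusFourierInv (fun k => (1 - (K.eval (latticeMomentum Lf k) : ℂ) *
              (u (latticeMomentum Lf k) / (1 + u (latticeMomentum Lf k) * K.eval (latticeMomentum Lf k)))) ^ 2) z‖) *
            (2 * N / |β| * ∑ p₁' : P', (Torus.tnorm (xg' p₁') : ℝ) * ‖kernel ℂ Wf 2 (fun i => ((![ι o, p₁'] i, 0), i))‖)) /
        (((Lc - 1) / 2 + 1 : ℕ) : ℝ))) := by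
  classical
  -- the explicit symbols as continuum functions
  set Es : (Fin 2 → ℝ) → ℂ := fun q => (K.eval q : ℂ) - (K.eval q : ℂ) ^ 2 * (u q / (1 + u q * K.eval q)) with hEs
  set τs : (Fin 2 → ℝ) → ℂ := fun q => (1 - (K.eval q : ℂ) * (u q / (1 + u q * K.eval q))) ^ 2 with hτs
  -- the resummed self-energies read through the grid representations
  set Sc : TorusSite 2 Lc → ℂ := fun k => selfEnergy Lc M β (ExteriorAlgebra.map (Matrix.toLin' (gridSubMatrix Lc M β xg τg)) Wc) (omega0 M, k) 0
    with hSc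
  set Sf : TorusSite 2 Lf → ℂ := fun k => selfEnergy Lf M β (ExteriorAlgebra.map (Matrix.toLin' (gridSubMatrix Lf M β xg' τg')) Wf) (omega0 M, k) 0
    with hSf
  -- the resummed reading at each volume
  have hreadc : ∀ k : TorusSite 2 Lc, klSelfEnergy Lc M β U μ K klE0 n (omega0 M, k) 0 =
      Es (latticeMomentum Lc k) + τs (latticeMomentum Lc k) * Sc k := by
    intro k
    rw [klSelfEnergy_eq_resummed hβ U μ K n (omega0 M) k 0 hZc (u (latticeMomentum Lc k)) (huc k), hSc]
    simp only [hEs, hτs]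
    rw [hrepc]
  have hreadf : ∀ k : TorusSite 2 Lf, klSelfEnergy Lf M β U μ K klE0 n (omega0 M, k) 0 =
      Es (latticeMomentum Lf k) + τs (latticeMomentum Lf k) * Sf k := by
    intro k
    rw [klSelfEnergy_eq_resummed hβ U μ K n (omega0 M) k 0 hZf (u (latticeMomentum Lf k)) (huf k), hSf]
    simp only [hEs, hτs]
    rw [hrepf]
  -- evenness of the explicit symbol on each grid (from the evenness of `p` and of `K`)
  have hLc : (Lc : ℝ) ≠ 0 := by exact_mod_cast NeZero.ne Lc
  have hLf : (Lf : ℝ) ≠ 0 := by exact_mod_cast NeZero.ne Lf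
  have hu_c : ∀ k : TorusSite 2 Lc, u (latticeMomentum Lc (-k)) = u (latticeMomentum Lc k) := by
    intro k
    have h1 := huc (-k)
    rw [uvSymbolCT_neg_momentum, huc k] at h1
    have hcc : ((β * (Lc : ℝ) ^ 2 : ℝ) : ℂ) ≠ 0 := by exact_mod_cast (by positivity : β * (Lc : ℝ) ^ 2 ≠ 0)
    exact (mul_left_cancel₀ hcc h1).symm
  have hu_f : ∀ k : TorusSite 2 Lf, u (latticeMomentum Lf (-k)) = u (latticeMomentum Lf k) := by
    intro k
    have h1 := huf (-k)
    rw [uvSymbolCT_neg_momentum, huf k] at h1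
    have hcc : ((β * (Lf : ℝ) ^ 2 : ℝ) : ℂ) ≠ 0 := by exact_mod_cast (by positivity : β * (Lf : ℝ) ^ 2 ≠ 0)
    exact (mul_left_cancel₀ hcc h1).symm
  have hEs_c : ∀ k : TorusSite 2 Lc, Es (latticeMomentum Lc (-k)) = Es (latticeMomentum Lc k) := by
    intro k; simp only [hEs, hu_c k, TrigPolyC4v.eval_latticeMomentum_neg]
  have hEs_f : ∀ k : TorusSite 2 Lf, Es (latticeMomentum Lf (-k)) = Es (latticeMomentum Lf k) := by
    intro k; simp only [hEs, hu_f k, TrigPolyC4v.eval_latticeMomentum_neg]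
  -- evenness of the dressed data (from (E0) parity of the full self-energy and of the explicit symbol)
  have hevenc : ∀ k : TorusSite 2 Lc, τs (latticeMomentum Lc (-k)) * Sc (-k) = τs (latticeMomentum Lc k) * Sc k := by
    intro k
    have h1 : τs (latticeMomentum Lc (-k)) * Sc (-k) = klSelfEnergy Lc M β U μ K klE0 n (omega0 M, -k) 0 - Es (latticeMomentum Lc (-k)) := by
      rw [hreadc (-k)]; ring
    have h2 : τs (latticeMomentum Lc k) * Sc k = klSelfEnergy Lc M β U μ K klE0 n (omega0 M, k) 0 - Es (latticeMomentum Lc k) := by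
      rw [hreadc k]; ring
    rw [h1, h2, klSelfEnergy_neg, hEs_c]
  have hevenf : ∀ k : TorusSite 2 Lf, τs (latticeMomentum Lf (-k)) * Sf (-k) = τs (latticeMomentum Lf k) * Sf k := by
    intro k
    have h1 : τs (latticeMomentum Lf (-k)) * Sf (-k) = klSelfEnergy Lf M β U μ K klE0 n (omega0 M, -k) 0 - Es (latticeMomentum Lf (-k)) := by
      rw [hreadf (-k)]; ring
    have h2 : τs (latticeMomentum Lf k) * Sf k = klSelfEnergy Lf M β U μ K klE0 n (omega0 M, k) 0 - Es (latticeMomentum Lf k) := by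
      rw [hreadf k]; ring
    rw [h1, h2, klSelfEnergy_neg, hEs_f]
  -- the localised data as «explicit + dressed»
  have hdatc : klLocSelfEnergyRe Lc M β U μ K n =
      fun k => (Es (latticeMomentum Lc k)).re + (τs (latticeMomentum Lc k) * Sc k).re := by
    funext k
    rw [klLocSelfEnergyRe_eq_re, hreadc k, Complex.add_re]
  have hdatf : klLocSelfEnergyRe Lf M β U μ K n =
      fun k => (Es (latticeMomentum Lf k)).re + (τs (latticeMomentum Lf k) * Sf k).re := by
    funext k
    rw [klLocSelfEnergyRe_eq_re, hreadf k, Complex.add_re]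
  -- the two halves
  set q := klFermiPoint μ K θ with hq
  have hexpl := abs_eval_symInterp_sampled_sub_le_two_far hL (fun q' => (Es q').re) q
  have hdress := abs_eval_symInterp_dressed_sub_le hL hβ.ne' xg τg xg' τg' hP hP' ι hι hιx hιτ hblock hxo Wc Wf (omega0 M) 0 τs
    hevenc hevenf hrowc hrowf q
  -- assemble
  unfold klLocalPart
  rw [hdatc, hdatf, eval_symInterp_add, eval_symInterp_add, ← hq]
  have e : (symInterp Lc fun k => (Es (latticeMomentum Lc k)).re).eval q + (symInterp Lc fun k => (τs (latticeMomentum Lc k) * Sc k).re).eval q -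
      ((symInterp Lf fun k => (Es (latticeMomentum Lf k)).re).eval q + (symInterp Lf fun k => (τs (latticeMomentum Lf k) * Sf k).re).eval q) =
      ((symInterp Lc fun k => (Es (latticeMomentum Lc k)).re).eval q - (symInterp Lf fun k => (Es (latticeMomentum Lf k)).re).eval q) +
        ((symInterp Lc fun k => (τs (latticeMomentum Lc k) * Sc k).re).eval q -
          (symInterp Lf fun k => (τs (latticeMomentum Lf k) * Sf k).re).eval q) := by ring
  rw [e]
  exact (abs_add_le _ _).trans (add_le_add hexpl hdress)

end Nested

end Summit.HubbardSuperconductivity.HubbardSuperconductivity.Theorems.TwoVolumeDefect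

end
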